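import Summits.ResolutionOfSingularities.ResolutionOfSingularities.Theorems.HilbertSamuelEliminationSigmaMaxModificationsCorridor3NearStep
import Literature.AlgebraicGeometry.Resolution.PermissibleBlowupDirectrixNear
import HarnessLib

/-!
# [OURS · L1 W4.2] `e` DOES NOT INCREASE at a near point with TRIVIAL residue extension (CJS Thm. 3.10 (4) with `δ = 0`,
# `K = κ(x′) = κ(x)`) — the `e ≤ 1` propagation step of the grade-1 / third-door point sequences of BOTH W-low rows
# (crux chain w42, line `w_ladder` v6; `--supports stmt-ResolutionOfSingularities-19249`, helper)

Stub worker res-L1-w42-stub-3 (gen 3). In a fundamental sequence at a point with `e_x(X) = 1` (CJS Cor. 6.37; the `e = 1` door of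
the sockets `IsoLowDirDimTerminatesQM` / `IsoLowDirDimTerminatesFreeM`) the near point `x′` over `x` is `κ(x)`-RATIONAL (it is the
point of `ℙ(Dir_x(X)) ≅ ℙ⁰_{κ(x)}`, tree fact `ProjDir_line`), and the next step needs `e_{x′}(X′) ≤ 1` again. The printed source of
that bound is CJS Thm. 3.10 (4) («`e_{x′}(X′)_K ≤ e_x(X)_K − δ_{x′/x}`», char-free; typed named fact
`CossartJannsenSaito2020_thm_3_10_4`, lead-1 p499783, consequences `…PermissibleBlowupDirectrixNear`): with `K = κ(x′)` and
`κ(x) → κ(x′)` BIJECTIVE, `e_x(X)_K = e_x(X)` (tree `directrixDim_map_eq_of_bijective`) and `e_{x′}(X′)_K = e_{x′}(X′)`, so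
`e_{x′}(X′) ≤ e_x(X)`. PROVED here, CONDITIONAL on that one printed fact (char-free, so it serves the (F1) row AND the
characteristic-2 row alike):

* `dirDimOver_eq_dirDim_of_bijective` — `e_x(X)_K = e_x(X)` for `κ(x) → K` bijective (pure directrix algebra, fact-free);
* `dirDim_le_dirDim_of_hsFun_eq_of_bijective` — scheme level: `x′` near over `x ∈ D` (permissible), residue map bijective ⇒
  `e_{x′}(X′) ≤ e_x(X)`;
* `dirDim_blowup_le_of_isCanonicalStep_of_bijective` — at a GOOD stage of `S(X, ν)` (s42's `StateGood`): for the canonical centre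
  `C ∋ x_n` and a point `x′ ∈ Bℓ_C(X_n)` over `x_n` in the `ν`-stratum with bijective residue map, `e_{x′} ≤ e_{x_n}`.

OURS bookkeeping; NOT statements of the manuscript [Hironaka2017] nor of [CossartJannsenSaito2020]; AI-written, weaker than expert
review. References: CJS LNM 2270 Thm. 3.10 (4), Lemma 2.10 (2), Def. 2.26, Cor. 6.37, p. 103 («if `e^O_x(X) ≤ 1` then `k(y) = k(x)`»)
[CossartJannsenSaito2020]; H. Hironaka, *Certain numerical characters of singularities* (1970), Thm. (1,A) [Hironaka1967Characters].
-/

noncomputable section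

-- namespace `…Corridor3.Moving` re-enters `…Corridor3` (module convention of the Moving files)
set_option linter.dupNamespace false

open CategoryTheory AlgebraicGeometry TopologicalSpace IsLocalRing
open Literature.AlgebraicGeometry.Resolution Literature.RingTheory.HilbertSamuel
open Summit.ResolutionOfSingularities.ResolutionOfSingularities.Theorems.CampaignW42
open Literature.AlgebraicGeometry.CossartJannsenSaito2020
open Summit.ResolutionOfSingularities.ResolutionOfSingularities.Theorems.SigmaMaxModificationsCorridor3

namespace Summit.ResolutionOfSingularities.ResolutionOfSingularities.Theorems.SigmaMaxModificationsCorridor3.Moving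

universe u

variable {R : ∀ S : Scheme.{u}, CentreSeq S → Prop} {N : ℕ} {ν : ℕ → ℕ}

/-- **`e_x(X)_K = e_x(X)` when `κ(x) → K` is BIJECTIVE** (the directrix dimension over an isomorphic copy of the residue field;
CJS Lemma 2.10 (2) both ways, tree `directrixDim_map_eq_of_bijective`). [cite: CossartJannsenSaito2020, Lemma 2.10 (2), Def. 2.26] -/
theorem dirDimOver_eq_dirDim_of_bijective {X : Scheme.{u}} [IsLocallyNoetherian X] (x : X) (K : Type u) [Field K]
    [Algebra (ResidueField (X.presheaf.stalk x)) K]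
    (hbij : Function.Bijective (algebraMap (ResidueField (X.presheaf.stalk x)) K)) :
    Scheme.dirDimOver X x K = Scheme.dirDim X x := by
  show Literature.RingTheory.HilbertSamuel.dirDimOver (X.presheaf.stalk x) K =
    Literature.RingTheory.HilbertSamuel.dirDim (X.presheaf.stalk x)
  unfold Literature.RingTheory.HilbertSamuel.dirDimOver Literature.RingTheory.HilbertSamuel.dirDim
  exact Literature.RingTheory.MvPolynomial.directrixDim_map_eq_of_bijective _ hbij _

/-- **`e_{x′}(X′) ≤ e_x(X)` at a NEAR point with BIJECTIVE residue map** (CJS Thm. 3.10 (4) with `K = κ(x′)`, `δ = 0`), modulo the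
char-free named fact `CossartJannsenSaito2020_thm_3_10_4`: `X` excellent, `D` permissible, `π` the blow-up in `D`, `N ≥ dim X`,
`x′` over `x ∈ D` with `H^N(x′) = H^N(x)` and `κ(x) → κ(x′)` bijective. [cite: CossartJannsenSaito2020, Thm. 3.10 (4)] -/
theorem dirDim_le_dirDim_of_hsFun_eq_of_bijective (h : CossartJannsenSaito2020_thm_3_10_4.{u})
    {X X' : Scheme.{u}} [IsLocallyNoetherian X] [IsLocallyNoetherian X'] {π : X' ⟶ X} {D : X.IdealSheafData}
    (hX : Scheme.IsExcellent X) (hD : IdealSheafData.IsPermissible D) (hπ : IsBlowup π D)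
    {N : ℕ} (hN : topologicalKrullDim X ≤ (N : WithBot ℕ∞)) {x' : X'} (hx : π.base x' ∈ (D.support : Set X))
    (hnear : Scheme.hsFun X' N x' = Scheme.hsFun X N (π.base x'))
    (hbij : Function.Bijective (π.residueFieldMap x').hom) :
    Scheme.dirDim X' x' ≤ Scheme.dirDim X (π.base x') := by
  letI : Algebra (ResidueField (X.presheaf.stalk (π.base x'))) (ResidueField (X'.presheaf.stalk x')) :=
    (π.residueFieldMap x').hom.toAlgebra
  have hle := dirDimOver_le_of_hsFun_eq h hX hD hπ hN hx hnear (ResidueField (X'.presheaf.stalk x')) (fun _ => rfl)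
  rw [Scheme.dirDimOver_residueField, dirDimOver_eq_dirDim_of_bijective (π.base x') _ hbij] at hle
  exact hle

/-- **At a GOOD stage of `S(X, ν)`: `e_{x′} ≤ e_{x_n}` for a point `x′` of the blow-up in the canonical centre `C ∋ x_n`, over `x_n`,
in the `ν`-stratum, with bijective residue map** (s42's `StateGood`: excellence, `dim ≤ N`, permissibility of the canonical centre);
modulo `CossartJannsenSaito2020_thm_3_10_4`. The `e ≤ 1` propagation step of the grade-1 point sequences (the near point is
`κ(x_n)`-rational there by `ProjDir_line`). [cite: CossartJannsenSaito2020, Thm. 3.10 (4), Cor. 6.37] -/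
theorem dirDim_blowup_le_of_isCanonicalStep_of_bijective (h : CossartJannsenSaito2020_thm_3_10_4.{u})
    {k : Type u} [Field k] {s : MarkedStage.{u}} (hg : StateGood k R N ν s.W s.L s.P)
    (hpt : s.pt ∈ Scheme.hsStratum s.W N ν) {C : s.W.IdealSheafData} {P' : Option (Pending (blowup C))}
    (hcs : IsCanonicalStep R N ν s.L s.P C P') (hmem : s.pt ∈ (C.support : Set s.W)) [IsLocallyNoetherian (blowup C)]
    {x' : ↥(blowup C)} (hπ : (blowup.π C).base x' = s.pt) (hx' : x' ∈ Scheme.hsStratum (blowup C) N ν)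
    (hbij : Function.Bijective ((blowup.π C).residueFieldMap x').hom) :
    Scheme.dirDim (blowup C) x' ≤ dirDim s := by
  haveI : IsLocallyNoetherian s.W := s.ln
  have hnear : Scheme.hsFun (blowup C) N x' = Scheme.hsFun s.W N ((blowup.π C).base x') := by
    rw [hπ, Scheme.mem_hsStratum_iff.mp hx', Scheme.mem_hsStratum_iff.mp hpt]
  have hle := dirDim_le_dirDim_of_hsFun_eq_of_bijective h hg.isExcellent (hg.isPermissible hcs) (blowup.isBlowup C)
    hg.dim_le (hπ ▸ hmem) hnear hbij
  rw [hπ] at hle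
  exact hle

end Summit.ResolutionOfSingularities.ResolutionOfSingularities.Theorems.SigmaMaxModificationsCorridor3.Moving

end
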